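import Summits.ResolutionOfSingularities.ResolutionOfSingularities.Theorems.HomologicalConductorNoZenoParasiteThreadless
import Summits.ResolutionOfSingularities.ResolutionOfSingularities.Theorems.HomologicalConductorNoZenoRelativeACC
import Summits.ResolutionOfSingularities.ResolutionOfSingularities.Theorems.HomologicalConductorNoZenoTowerNoetherian
import Summits.ResolutionOfSingularities.ResolutionOfSingularities.Theorems.HomologicalConductorNoZenoDim2RegularCentre
import Summits.ResolutionOfSingularities.ResolutionOfSingularities.Theorems.HomologicalConductorNoZenoUnitOfRegularCentre
import HarnessLib

/-!
# Route `HomologicalConductor`, crux `NoZenoR` (stmt-ResolutionOfSingularities-19943) / `NoZeno` (16483), stub β1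
# `stub_kernelThreadless`: the COARSENING-THREAD lemmas (port of res-L0-w44-idea-1's `Sketch-idea-1-r10.lean`
# sha16 d23340d493481afc, §r10.1–§r10.3, §r10.5–§r10.6; card 8 `coarsening-thread`)

`[OURS · L W4.4]` Cell res-hironaka, crux chain W4.4.  Author of record of the mathematics AND of the Lean proofs below:
res-L0-w44-idea-1 (gen 10, technique A); this file (lead prover res-L0-w44-lead-1 gen 5) ports the sketch's def-free
theorems to the tree verbatim (namespace renamed), so that the β1 line of the registered skeleton can cite them by name.
The sketch's `def`s (`Beta1`, `Beta1Dense`, `TailInRegularHull`, `Beta1RankOne`, `Beta1CompositeDense`) and the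
compositions over them are SKELETON material and are NOT landed here; `tailInRegularHull_of_noThread` is restated
def-free.  Nothing here is a statement of the manuscript under review (Hironaka 2017); AI-written, weaker than expert
review.

THE LEVER.  For a coarsening `U > O` the centres `Q_m := T_m ∩ 𝔪_U` of `U` on the stages form a compatible family of
primes with an escape witness (β1's maximality witness `s`: `s⁻¹ ∈ U ∖ O`).  Hence EITHER `ca(T_m) ⊆ Q_m` for all `m` — a
`SingularPrimeThread` — OR some `ca(T_m)` holds a `U`-unit.  So in a THREADLESS kernel tower every proper coarsening is
unit-creating (`unitCreating_of_noThread`, CT), and: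
* the DISCRETE-SOCLE case of β1 is closed by the tree's `stub_relativeACC`: if some coarsening `U > O` has the descending
  chain condition on `U`-unit values in `O`, the threadless kernel tower terminates (`kernelThreadless_of_discreteCoarsening`);
* ISO AT THE COARSENING CENTRE: once `ca(T_m)` holds an `O₁`-unit (which persists, `unit_persists`), `chart O T_m ≤ loc O₁ T_m`
  (`chart_le_loc_of_unit`), the whole tail lies in ONE localisation `loc O₁ T_(m₁)` (`tower_le_loc_of_unit`), and the centre
  of `O₁` on every later stage is a regular point (`isRegularLocalRing_atPrime_of_unit`, Iyengar–Takahashi 5.4 = tree theorem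
  `singEqVCa_essFiniteType_holds`): `exists_regularHull_of_noThread`;
* the residual, sharpened: `stub_relativeACC` needs its chain condition only for chains drawn from the tower's own `ca`'s
  (`relativeACC_tower`), hence only for `O₁`-units of the hull (`kernelThreadless_of_hullChains`): β1 for COMPOSITE data
  reduces to a chain condition one transcendence degree down; the rank-one threadless case gets nothing from this file.

[cite: IyengarTakahashi2014, Theorem 5.4]
-/

-- single-problem summit: the doubled namespace component `ResolutionOfSingularities` is forced
set_option linter.dupNamespace false

noncomputable section

namespace Summit.ResolutionOfSingularities.ResolutionOfSingularities.Theorems.NoZeno.Coarsening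

open Summit.ResolutionOfSingularities.ResolutionOfSingularities.Theses.HomologicalConductor
open Summit.ResolutionOfSingularities.ResolutionOfSingularities.Theorems.NoZeno.Birth
open Summit.ResolutionOfSingularities.ResolutionOfSingularities.Theorems.NoZeno.SandwichCluster.Parasite
open Summit.ResolutionOfSingularities.ResolutionOfSingularities.Theorems

variable {k K : Type} [Field k] [Field K] [Algebra k K]

/-! ## §r10.1 Two bridges -/

/-- The `T`-span of `ca T` inside `K` is `ca T` itself (`ca T` is the image of the IDEAL `cohomologyAnnihilator ↥T`).
[folklore] -/
theorem mem_ca_of_mem_span (T : Subalgebra k K) {y : K}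
    (hy : y ∈ Submodule.span ↥T (ca T)) : y ∈ ca T := by
  induction hy using Submodule.span_induction with
  | mem x hx => exact hx
  | zero =>
    have h := (tn_coe_mem_ca_iff T 0).mpr (Ideal.zero_mem _)
    simpa using h
  | add x y _ _ hx hy =>
    have hx' := (tn_coe_mem_ca_iff T ⟨x, ca_subset T hx⟩).mp hx
    have hy' := (tn_coe_mem_ca_iff T ⟨y, ca_subset T hy⟩).mp hy
    have h := (tn_coe_mem_ca_iff T (⟨x, ca_subset T hx⟩ + ⟨y, ca_subset T hy⟩)).mpr
      (Ideal.add_mem _ hx' hy')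
    simpa using h
  | smul a x _ hx =>
    have hx' := (tn_coe_mem_ca_iff T ⟨x, ca_subset T hx⟩).mp hx
    have h := (tn_coe_mem_ca_iff T (a * ⟨x, ca_subset T hx⟩)).mpr (Ideal.mul_mem_left _ a hx')
    simpa [Subalgebra.smul_def] using h

/-- An element of `O` whose inverse is NOT in `O` has value `< 1`. [folklore] -/
theorem valuation_lt_one_of_inv_not_mem (O : ValuationSubring K) {s : K} (hs : s ∈ O)
    (hsi : s⁻¹ ∉ O) : O.valuation s < 1 := by
  rcases ((O.valuation_le_one_iff s).mpr hs).lt_or_eq with h | h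
  · exact h
  · exact absurd ((O.valuation_le_one_iff s⁻¹).mp (by rw [map_inv₀, h, inv_one])) hsi

/-! ## §r10.2 LEMMA CT — threadless ⟹ every coarsening is unit-creating -/

/-- **CT (coarsening-thread lemma; PROVED).** Along a tower with radical persistence, a non-zero centre and NO
singular prime thread, every valuation ring `U` into which some stage element escapes as a unit (`s ∈ T_m`,
`s⁻¹ ∈ U ∖ O` — for a coarsening `U > O` this is the maximality witness `hmax U`) is UNIT-CREATING: some non-zero
`c ∈ ca(T_M)` is a `U`-unit.  Proof: by Parasite III (`exists_mem_singRad_of_noThread`) the positive-value element `s`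
lies in `√(ca(T_M)·T_M)` for some `M ≥ m`; take `c = s^n ∈ ca(T_M)`.  Equivalently: the centres of `U` on the stages
would otherwise form a `SingularPrimeThread`. [this work] -/
theorem unitCreating_of_noThread (O : ValuationSubring K) (A : Subalgebra k K)
    (hk : ∀ c : k, algebraMap k K c ∈ O) (hA : A.FG) (hfr : IsFractionRing ↥A K)
    (hAO : A.toSubring ≤ O.toSubring)
    (hPR : ∀ m : ℕ, ∀ x ∈ ca (tower O A m), ∃ N : ℕ, 1 ≤ N ∧ x ^ N ∈ ca (tower O A (m + 1)))
    (hne : ∃ m, ∃ x ∈ ca (tower O A m), x ≠ 0) (hthr : ¬ SingularPrimeThread O A)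
    (U : ValuationSubring K) (hesc : ∃ m : ℕ, ∃ s ∈ tower O A m, s⁻¹ ∈ U ∧ s⁻¹ ∉ O) :
    ∃ m : ℕ, ∃ c ∈ ca (tower O A m), c ≠ 0 ∧ c⁻¹ ∈ U := by
  obtain ⟨m, s, hs, hsU, hsO⟩ := hesc
  have hsO' : s ∈ O := (tn_tower_invariant O A hk hA hfr hAO m).2.1 hs
  have hvs : O.valuation s < 1 := valuation_lt_one_of_inv_not_mem O hsO' hsO
  have hs0 : s ≠ 0 := by
    rintro rfl
    exact hsO (by rw [inv_zero]; exact O.zero_mem)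
  obtain ⟨M, hmM, hM⟩ := exists_mem_singRad_of_noThread O A hPR hne hthr hs hvs
  have hsM : s ∈ tower O A M := d2rc_mem_tower_of_le O A hmM hs
  obtain ⟨n, hn⟩ := Ideal.mem_radical_iff.mp (hM hsM)
  have hspan := coe_mem_span_ca_of_mem_caIdeal O A M hn
  rw [Subalgebra.coe_pow] at hspan
  refine ⟨M, s ^ n, mem_ca_of_mem_span _ hspan, pow_ne_zero _ hs0, ?_⟩
  rw [← inv_pow]
  exact pow_mem hsU n

/-! ## §r10.3 COROLLARY — the discrete-socle case of β1 is closed by `stub_relativeACC` -/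

/-- **β1, DISCRETE-SOCLE CASE (PROVED).** Over the β1 binders that matter here (`PersistenceRadical`, `StrictDrop`,
the datum, the maximality `hmax`, threadlessness): if SOME coarsening `U > O` has the descending chain condition on
`U`-unit values in `O` (no infinite strictly descending chain `v(z₀) > v(z₁) > ⋯` of `U`-units of `O`; equivalently
the finest non-zero convex subgroup of `Γ_O` is `ℤ` and `U` is the immediate coarsening), then some stage is
regular.  CT feeds the landed `stub_relativeACC` (p172572); the non-zero centre comes from `StrictDrop` at stage `0`.
The hypotheses `hker`, IH, `hzd`, `3 ≤ tr.deg` of β1 are not needed. [this work] -/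
theorem kernelThreadless_of_discreteCoarsening (hP : PersistenceRadical) (hD : StrictDrop) (p : ℕ)
    (hp : p.Prime) (k K : Type) [Field k] [CharP k p] [Field K] [Algebra k K] (O : ValuationSubring K)
    (A : Subalgebra k K) (hk : ∀ c : k, algebraMap k K c ∈ O) (hA : A.FG)
    (hfr : IsFractionRing ↥A K) (hAO : A.toSubring ≤ O.toSubring)
    (hmax : ∀ O' : ValuationSubring K, O < O' → ∃ m : ℕ, ∃ s ∈ tower O A m, s⁻¹ ∈ O' ∧ s⁻¹ ∉ O)
    (hthr : ¬ SingularPrimeThread O A)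
    (U : ValuationSubring K) (hOU : O < U)
    (hacc : ∀ z : ℕ → K, (∀ n : ℕ, z n ∈ O ∧ z n ≠ 0 ∧ (z n)⁻¹ ∈ U) →
      (∀ n : ℕ, z n * (z (n + 1))⁻¹ ∈ O) → ∃ n : ℕ, z (n + 1) * (z n)⁻¹ ∈ O) :
    ∃ m : ℕ, IsRegularLocalRing ↥(tower O A m) := by
  classical
  by_cases h0 : IsRegularLocalRing ↥(tower O A 0)
  · exact ⟨0, h0⟩
  -- the route hypotheses specialised to the named tower (definitional unfolding of their `let`s)
  have hPR : ∀ m : ℕ, ∀ x ∈ ca (tower O A m), ∃ N : ℕ, 1 ≤ N ∧ x ^ N ∈ ca (tower O A (m + 1)) :=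
    hP p hp k K O A hk hA hfr hAO
  have hdrop : ∀ m : ℕ, ¬ IsRegularLocalRing ↥(tower O A m) → ∃ m' : ℕ, m < m' ∧
      ∃ y ∈ ca (tower O A m'), y ≠ 0 ∧ ∀ x ∈ ca (tower O A m), x ≠ 0 → y * x⁻¹ ∉ O :=
    hD p hp k K O A hk hA hfr hAO
  have hne : ∃ m, ∃ x ∈ ca (tower O A m), x ≠ 0 := by
    obtain ⟨m', -, y, hy, hy0, -⟩ := hdrop 0 h0
    exact ⟨m', y, hy, hy0⟩
  exact stub_relativeACC hD p hp k K O A hk hA hfr hAO U hOU.le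
    (unitCreating_of_noThread O A hk hA hfr hAO hPR hne hthr U (hmax U hOU)) hacc

/-! ## §r10.5 Iso at the coarsening centre (first inclusion proved; the hull statement typed) -/

/-- **The chart stays inside the localisation at the coarser centre.**  If `T ⊆ O ≤ O₁` and `ca T` holds a non-zero
`O₁`-unit `c₁`, then the `O`-chart of the blow-up of `T` along `ca T` lies in `loc O₁ T = T_(T ∩ 𝔪_{O₁})`: the
minimal-value denominators `x` satisfy `c₁ * x⁻¹ ∈ O ⊆ O₁`, hence `x⁻¹ = c₁⁻¹ * (c₁ * x⁻¹) ∈ O₁`. [this work] -/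
theorem chart_le_loc_of_unit (O O₁ : ValuationSubring K) (hO : O ≤ O₁) (T : Subalgebra k K)
    (hc : ∃ c₁ ∈ ca T, c₁ ≠ 0 ∧ c₁⁻¹ ∈ O₁) : chart O T ≤ loc O₁ T := by
  obtain ⟨c₁, hc₁, hc₁0, hc₁i⟩ := hc
  refine Algebra.adjoin_le ?_
  rintro y (hy | ⟨c, hc, x, hx, hx0, hmin, rfl⟩)
  · exact Algebra.subset_adjoin ⟨y, hy, 1, T.one_mem, by rw [inv_one]; exact O₁.one_mem,
      by rw [inv_one, mul_one]⟩
  · have hxi : x⁻¹ ∈ O₁ := by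
      have h1 : c₁ * x⁻¹ ∈ O₁ := hO (hmin c₁ hc₁)
      have h2 : x⁻¹ = c₁⁻¹ * (c₁ * x⁻¹) := by rw [← mul_assoc, inv_mul_cancel₀ hc₁0, one_mul]
      rw [h2]
      exact mul_mem hc₁i h1
    exact Algebra.subset_adjoin ⟨c, ca_subset T hc, x, ca_subset T hx, hxi, rfl⟩

/-- A `U`-unit in `ca` PERSISTS up the tower (radical persistence: `c ↦ c^N`). [this work] -/
theorem unit_persists (O : ValuationSubring K) (A : Subalgebra k K)
    (hPR : ∀ m : ℕ, ∀ x ∈ ca (tower O A m), ∃ N : ℕ, 1 ≤ N ∧ x ^ N ∈ ca (tower O A (m + 1)))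
    (U : ValuationSubring K) {m₁ : ℕ} (h : ∃ c ∈ ca (tower O A m₁), c ≠ 0 ∧ c⁻¹ ∈ U)
    {m : ℕ} (hm : m₁ ≤ m) : ∃ c ∈ ca (tower O A m), c ≠ 0 ∧ c⁻¹ ∈ U := by
  induction hm with
  | refl => exact h
  | step _ ih =>
    obtain ⟨c, hc, hc0, hci⟩ := ih
    obtain ⟨N, -, hN⟩ := hPR _ c hc
    exact ⟨c ^ N, hN, pow_ne_zero _ hc0, by rw [← inv_pow]; exact pow_mem hci N⟩

/-- **The coarser centre is a REGULAR point as soon as `ca` holds a unit of the coarsening** (easy direction of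
`Sing = V(ca)`, Iyengar–Takahashi 5.4, the tree's named fact `singEqVCa_essFiniteType`, PROVED in the tree as
`singEqVCa_essFiniteType_holds`): if `c ∈ ca(T_m)` is a non-zero `U`-unit and `𝔭 = T_m ∩ 𝔪_U` is the centre of
`U`, then `(T_m)_𝔭` is regular.  The plumbing is that of the tree's `stub_unitOfRegularCentre` run backwards.
[cite: IyengarTakahashi2014, Thm. 5.4] -/
theorem isRegularLocalRing_atPrime_of_unit
    (h54 : Literature.RingTheory.CohomologyAnnihilator.singEqVCa_essFiniteType.{0})
    (O : ValuationSubring K) (A : Subalgebra k K)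
    (hk : ∀ c : k, algebraMap k K c ∈ O) (hA : A.FG) (hfr : IsFractionRing ↥A K)
    (hAO : A.toSubring ≤ O.toSubring) (U : ValuationSubring K) (m : ℕ)
    (hc : ∃ c ∈ ca (tower O A m), c ≠ 0 ∧ c⁻¹ ∈ U)
    (𝔭 : Ideal ↥(tower O A m)) [𝔭.IsPrime]
    (h𝔭 : ∀ x : ↥(tower O A m), x ∈ 𝔭 ↔ (x : K) ∈ U.nonunits) :
    IsRegularLocalRing (Localization.AtPrime 𝔭) := by
  obtain ⟨-, -, hET⟩ := tn_tower_invariant O A hk hA hfr hAO m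
  haveI := hET
  obtain ⟨d, hd, -⟩ := Literature.AlgebraicGeometry.Resolution.exists_ringKrullDim_eq_and_trdeg_eq k
    ↥(Algebra.EssFiniteType.subalgebra k ↥(tower O A m))
  have key : Literature.RingTheory.CohomologyAnnihilator.ca ↥(tower O A m) ≤ 𝔭 ↔
      ¬ IsRegularLocalRing (Localization.AtPrime 𝔭) :=
    (h54 k ↥(Algebra.EssFiniteType.subalgebra k ↥(tower O A m)) inferInstance d hd
      (Algebra.EssFiniteType.submonoid k ↥(tower O A m)) ↥(tower O A m) inferInstance 𝔭).1
  obtain ⟨c, hc, hc0, hci⟩ := hc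
  by_contra hreg
  have hcT : c ∈ tower O A m := ca_subset _ hc
  have hc' : (⟨c, hcT⟩ : ↥(tower O A m)) ∈
      Literature.RingTheory.CohomologyAnnihilator.ca ↥(tower O A m) := by
    rw [Literature.RingTheory.CohomologyAnnihilator.ca_eq_cohomologyAnnihilator]
    exact (tn_coe_mem_ca_iff (tower O A m) ⟨c, hcT⟩).mp hc
  have hcp : (c : K) ∈ U.nonunits := (h𝔭 _).mp (key.mpr hreg hc')
  rw [ValuationSubring.mem_nonunits_iff_or] at hcp
  rcases hcp with h | h
  · exact hc0 h
  · exact h hci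

/-- **ISO AT THE COARSENING CENTRE — the tail of the tower lives in ONE localisation (PROVED).**  If `T ⊆ O ≤ O₁`,
`ca(T_(m₁))` holds a non-zero `O₁`-unit, `m₁ ≥ 1` (so the stages are normal) and radical persistence holds, then
for every `m ≥ m₁`: `T_m ≤ R := loc O₁ (T_(m₁))`, the localisation of stage `m₁` at the centre of `O₁`.  Step:
`chart O T_m ≤ loc O₁ T_m ≤ R` (`chart_le_loc_of_unit`, idempotence of `loc O₁`), `nrm (chart) ≤ nrm R = R` (`R`
is integrally closed), `loc O (nrm chart) ≤ loc O₁ (nrm chart) ≤ R`. With `isRegularLocalRing_atPrime_of_unit`, `R`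
is a REGULAR local ring: the whole tail is sandwiched `T_m ≤ R = (T_m)_(Q_m)`, `R` constant. [this work] -/
theorem tower_le_loc_of_unit (O : ValuationSubring K) (A : Subalgebra k K)
    (hk : ∀ c : k, algebraMap k K c ∈ O) (hA : A.FG) (hfr : IsFractionRing ↥A K)
    (hAO : A.toSubring ≤ O.toSubring)
    (hPR : ∀ m : ℕ, ∀ x ∈ ca (tower O A m), ∃ N : ℕ, 1 ≤ N ∧ x ^ N ∈ ca (tower O A (m + 1)))
    (O₁ : ValuationSubring K) (hO : O ≤ O₁) {n₁ : ℕ}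
    (hc : ∃ c ∈ ca (tower O A (n₁ + 1)), c ≠ 0 ∧ c⁻¹ ∈ O₁)
    {m : ℕ} (hm : n₁ + 1 ≤ m) : tower O A m ≤ loc O₁ (tower O A (n₁ + 1)) := by
  haveI := hfr
  -- the hull `R = loc O₁ T_(n₁+1)`: integrally closed with fraction field `K`, idempotent under `loc O₁`
  have hT₁ := tn_tower_invariant O A hk hA hfr hAO (n₁ + 1)
  have hT₁O : (tower O A (n₁ + 1)).toSubring ≤ O.toSubring := hT₁.2.1
  have hT₁O₁ : (tower O A (n₁ + 1)).toSubring ≤ O₁.toSubring := fun x hx => hO (hT₁O hx)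
  haveI : IsIntegrallyClosed ↥(tower O A (n₁ + 1)) := d2rc_isIntegrallyClosed_tower_succ O A hk hA hfr hAO n₁
  haveI hRint : IsIntegrallyClosed ↥(loc O₁ (tower O A (n₁ + 1))) :=
    SyzygyFlattening.isIntegrallyClosed_locAt O₁ _ hT₁O₁
  haveI hRfr : IsFractionRing ↥(loc O₁ (tower O A (n₁ + 1))) K :=
    Literature.AlgebraicGeometry.Resolution.isFractionRing_subalgebra_of_le A _
      (hT₁.1.trans (SyzygyFlattening.self_le_locAt O₁ _))
  have hRR : loc O₁ (loc O₁ (tower O A (n₁ + 1))) = loc O₁ (tower O A (n₁ + 1)) :=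
    SyzygyFlattening.locAt_locAt O₁ _ hT₁O₁
  have hnrmR := SyzygyFlattening.nrm_eq_self_of_isIntegrallyClosed (loc O₁ (tower O A (n₁ + 1)))
  induction hm with
  | refl => exact SyzygyFlattening.self_le_locAt O₁ _
  | @step m hm ih =>
    -- an `O₁`-unit in `ca(T_m)` and `T_m ⊆ O`
    have hcm := unit_persists O A hPR O₁ hc hm
    have hTm := tn_tower_invariant O A hk hA hfr hAO m
    have hTmO : (tower O A m).toSubring ≤ O.toSubring := hTm.2.1
    -- (1) the chart
    have h1 : chart O (tower O A m) ≤ loc O₁ (tower O A (n₁ + 1)) := by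
      refine (chart_le_loc_of_unit O O₁ hO (tower O A m) hcm).trans ?_
      rw [← hRR]
      exact SyzygyFlattening.locAt_mono O₁ ih
    -- (2) its normalisation
    have h2 : nrm (chart O (tower O A m)) ≤ loc O₁ (tower O A (n₁ + 1)) := by
      exact (SyzygyFlattening.nrm_mono h1).trans (le_of_eq hnrmR)
    -- (3) the localisation at the centre of `O`
    have hcO : (chart O (tower O A m)).toSubring ≤ O.toSubring := by
      refine SyzygyFlattening.adjoin_toSubring_le_valuationSubring O hk ?_
      rintro y (hy | ⟨c, hc', x, -, -, hmin, rfl⟩)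
      · exact hTmO (Subalgebra.mem_toSubring.mpr hy)
      · exact hmin c hc'
    have hNO : (nrm (chart O (tower O A m))).toSubring ≤ O.toSubring :=
      SyzygyFlattening.nrm_toSubring_le O hk hcO
    rw [tower_succ]
    refine (SyzygyFlattening.locAt_le_locAt_of_le O O₁ hO _ hNO).trans ?_
    rw [← hRR]
    exact SyzygyFlattening.locAt_mono O₁ h2


/-- **The tail lives in a regular hull (PROVED; def-free form of the sketch's `tailInRegularHull_of_noThread`).**  A
COMPOSITE (`O < O₁ < K` for some `O₁`) threadless tower with radical persistence, a non-zero centre and the maximality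
witnesses `hmax` has, for some coarsening `O₁` and some stage `m₁`: the centre of `O₁` on every stage `m ≥ m₁` is a
REGULAR point, and every stage `m ≥ m₁` lies in the hull `loc O₁ T_(m₁)`.  Inputs: CT, `unit_persists`,
Iyengar–Takahashi 5.4 (`h54`, proved in the tree), `tower_le_loc_of_unit`. [this work] -/
theorem exists_regularHull_of_noThread
    (h54 : Literature.RingTheory.CohomologyAnnihilator.singEqVCa_essFiniteType.{0})
    (O : ValuationSubring K) (A : Subalgebra k K)
    (hk : ∀ c : k, algebraMap k K c ∈ O) (hA : A.FG) (hfr : IsFractionRing ↥A K)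
    (hAO : A.toSubring ≤ O.toSubring)
    (hPR : ∀ m : ℕ, ∀ x ∈ ca (tower O A m), ∃ N : ℕ, 1 ≤ N ∧ x ^ N ∈ ca (tower O A (m + 1)))
    (hne : ∃ m, ∃ x ∈ ca (tower O A m), x ≠ 0) (hthr : ¬ SingularPrimeThread O A)
    (hmax : ∀ O' : ValuationSubring K, O < O' → ∃ m : ℕ, ∃ s ∈ tower O A m, s⁻¹ ∈ O' ∧ s⁻¹ ∉ O)
    (hrk : ∃ O₁ : ValuationSubring K, O < O₁ ∧ O₁ ≠ ⊤) :
    ∃ O₁ : ValuationSubring K, O < O₁ ∧ O₁ ≠ ⊤ ∧ ∃ m₁ : ℕ,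
      (∀ m : ℕ, m₁ ≤ m → ∀ (𝔭 : Ideal ↥(tower O A m)) (_ : 𝔭.IsPrime),
        (∀ x : ↥(tower O A m), x ∈ 𝔭 ↔ (x : K) ∈ O₁.nonunits) →
          IsRegularLocalRing (Localization.AtPrime 𝔭)) ∧
      ∀ m : ℕ, m₁ ≤ m → tower O A m ≤ loc O₁ (tower O A m₁) := by
  obtain ⟨O₁, hOO₁, hO₁⟩ := hrk
  obtain ⟨M, hcM⟩ := unitCreating_of_noThread O A hk hA hfr hAO hPR hne hthr O₁ (hmax O₁ hOO₁)
  -- move to stage `M + 1` (normal stages)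
  have hc₁ : ∃ c ∈ ca (tower O A (M + 1)), c ≠ 0 ∧ c⁻¹ ∈ O₁ :=
    unit_persists O A hPR O₁ hcM (Nat.le_succ M)
  refine ⟨O₁, hOO₁, hO₁, M + 1, fun m hm 𝔭 _ h𝔭 => ?_, fun m hm => ?_⟩
  · exact isRegularLocalRing_atPrime_of_unit h54 O A hk hA hfr hAO O₁ m
      (unit_persists O A hPR O₁ hc₁ hm) 𝔭 h𝔭
  · exact tower_le_loc_of_unit O A hk hA hfr hAO hPR O₁ hOO₁.le hc₁ hm

/-! ## §r10.6 The residual, sharpened: only chains INSIDE THE HULL matter (PROVED) -/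

/-- **`stub_relativeACC` refined (PROVED, same proof): the chain condition is only needed for chains drawn from
the tower's own `ca`-ideals at stages `≥ m₀`.**  The Zeno chain produced by iterating `StrictDrop` from a
`U`-unit `c ∈ ca(T_(m₀))` consists of elements `zₙ ∈ ca(T_(mₙ))`, `m₀ ≤ mₙ` increasing. [this work; proof adapted
from the tree's `stub_relativeACC`] -/
theorem relativeACC_tower (hD : StrictDrop) (p : ℕ) (hp : p.Prime) (k K : Type) [Field k]
    [CharP k p] [Field K] [Algebra k K] (O : ValuationSubring K) (A : Subalgebra k K)
    (hk : ∀ c : k, algebraMap k K c ∈ O) (hA : A.FG) (hfr : IsFractionRing ↥A K)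
    (hAO : A.toSubring ≤ O.toSubring) (U : ValuationSubring K) (hOU : O ≤ U) (m₀ : ℕ)
    (hunit : ∃ c ∈ ca (tower O A m₀), c ≠ 0 ∧ c⁻¹ ∈ U)
    (hacc : ∀ z : ℕ → K,
      (∀ n : ℕ, (∃ m : ℕ, m₀ ≤ m ∧ z n ∈ ca (tower O A m)) ∧ z n ≠ 0 ∧ (z n)⁻¹ ∈ U) →
      (∀ n : ℕ, z n * (z (n + 1))⁻¹ ∈ O) → ∃ n : ℕ, z (n + 1) * (z n)⁻¹ ∈ O) :
    ∃ m : ℕ, IsRegularLocalRing ↥(tower O A m) := by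
  have hdrop : ∀ m : ℕ, ¬ IsRegularLocalRing ↥(tower O A m) → ∃ m' : ℕ, m < m' ∧
      ∃ y ∈ ca (tower O A m'), y ≠ 0 ∧ ∀ x ∈ ca (tower O A m), x ≠ 0 → y * x⁻¹ ∉ O :=
    hD p hp k K O A hk hA hfr hAO
  by_contra hcon
  push Not at hcon
  have hstep :
      ∀ q : {q : ℕ × K // m₀ ≤ q.1 ∧ q.2 ∈ ca (tower O A q.1) ∧ q.2 ≠ 0 ∧ q.2⁻¹ ∈ U},
      ∃ q' : {q : ℕ × K // m₀ ≤ q.1 ∧ q.2 ∈ ca (tower O A q.1) ∧ q.2 ≠ 0 ∧ q.2⁻¹ ∈ U},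
        q'.1.2 * (q.1.2)⁻¹ ∉ O := by
    rintro ⟨⟨m, x⟩, hm, hx, hx0, hxU⟩
    obtain ⟨m', hmm', y, hy, hy0, hlt⟩ := hdrop m (hcon m)
    have h1 : y * x⁻¹ ∉ O := hlt x hx hx0
    have h2 : x * y⁻¹ ∈ O := by
      rcases O.mem_or_inv_mem (y * x⁻¹) with h | h
      · exact absurd h h1
      · rwa [mul_inv_rev, inv_inv] at h
    have h3 : y⁻¹ ∈ U := by
      have h4 : x⁻¹ * (x * y⁻¹) ∈ U := U.mul_mem _ _ hxU (hOU h2)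
      rwa [inv_mul_cancel_left₀ hx0] at h4
    exact ⟨⟨(m', y), le_of_lt (lt_of_le_of_lt hm hmm'), hy, hy0, h3⟩, h1⟩
  choose F hF using hstep
  obtain ⟨c, hc, hc0, hcU⟩ := hunit
  obtain ⟨s, hs⟩ :
      ∃ s : ℕ → {q : ℕ × K // m₀ ≤ q.1 ∧ q.2 ∈ ca (tower O A q.1) ∧ q.2 ≠ 0 ∧ q.2⁻¹ ∈ U},
      ∀ n : ℕ, s (n + 1) = F (s n) :=
    ⟨fun n => Nat.rec ⟨(m₀, c), le_rfl, hc, hc0, hcU⟩ (fun _ q => F q) n, fun _ => rfl⟩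
  obtain ⟨n, hn⟩ := hacc (fun n => (s n).1.2)
    (fun n => ⟨⟨(s n).1.1, (s n).2.1, (s n).2.2.1⟩, (s n).2.2.2.1, (s n).2.2.2.2⟩)
    (fun n => by
      rcases O.mem_or_inv_mem ((F (s n)).1.2 * ((s n).1.2)⁻¹) with h | h
      · exact absurd h (hF (s n))
      · rw [mul_inv_rev, inv_inv] at h
        show (s n).1.2 * ((s (n + 1)).1.2)⁻¹ ∈ O
        rw [hs n]
        exact h)
  have hn' : (s (n + 1)).1.2 * ((s n).1.2)⁻¹ ∈ O := hn
  rw [hs n] at hn'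
  exact hF (s n) hn'

/-- **β1 FOR COMPOSITE DATA REDUCES TO THE CHAIN CONDITION ON THE HULL (PROVED).**  Threadless kernel datum, `O < O₁`
a proper coarsening: if for every stage `m₁` the `O`-values of the `O₁`-UNITS OF `loc O₁ (T_(m₁))` satisfy the
descending chain condition of `stub_relativeACC`, the tower terminates.  By §r10.5 the hull `R = loc O₁ (T_(m₁))`
is eventually constant and regular, its `O₁`-units are its units, and their `O`-values form the value group `Δ_R`
of the residual valuation `Ō` on the residue field `κ(R)` — finitely generated over `k` of transcendence degree
`n − dim R ≤ n − 1`.  So the ONLY composite habitat of β1 left open is: `Δ_R` rank one and DENSE (card 8, §8.6: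
for `n = 3` this forces `dim R = 1`, `R = O₁` a prime divisor OF THE TOWER, `Ō` non-discrete on the surface field
`κ(O₁)`). [this work] -/
theorem kernelThreadless_of_hullChains (hP : PersistenceRadical) (hD : StrictDrop) (p : ℕ)
    (hp : p.Prime) (k K : Type) [Field k] [CharP k p] [Field K] [Algebra k K] (O : ValuationSubring K)
    (A : Subalgebra k K) (hk : ∀ c : k, algebraMap k K c ∈ O) (hA : A.FG)
    (hfr : IsFractionRing ↥A K) (hAO : A.toSubring ≤ O.toSubring)
    (hmax : ∀ O' : ValuationSubring K, O < O' → ∃ m : ℕ, ∃ s ∈ tower O A m, s⁻¹ ∈ O' ∧ s⁻¹ ∉ O)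
    (hthr : ¬ SingularPrimeThread O A) (O₁ : ValuationSubring K) (hOO₁ : O < O₁)
    (hacc : ∀ m₁ : ℕ, ∀ z : ℕ → K,
      (∀ n : ℕ, z n ∈ loc O₁ (tower O A m₁) ∧ z n ≠ 0 ∧ (z n)⁻¹ ∈ O₁) →
      (∀ n : ℕ, z n * (z (n + 1))⁻¹ ∈ O) → ∃ n : ℕ, z (n + 1) * (z n)⁻¹ ∈ O) :
    ∃ m : ℕ, IsRegularLocalRing ↥(tower O A m) := by
  classical
  by_cases h0 : IsRegularLocalRing ↥(tower O A 0)
  · exact ⟨0, h0⟩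
  have hPR : ∀ m : ℕ, ∀ x ∈ ca (tower O A m), ∃ N : ℕ, 1 ≤ N ∧ x ^ N ∈ ca (tower O A (m + 1)) :=
    hP p hp k K O A hk hA hfr hAO
  have hdrop : ∀ m : ℕ, ¬ IsRegularLocalRing ↥(tower O A m) → ∃ m' : ℕ, m < m' ∧
      ∃ y ∈ ca (tower O A m'), y ≠ 0 ∧ ∀ x ∈ ca (tower O A m), x ≠ 0 → y * x⁻¹ ∉ O :=
    hD p hp k K O A hk hA hfr hAO
  have hne : ∃ m, ∃ x ∈ ca (tower O A m), x ≠ 0 := by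
    obtain ⟨m', -, y, hy, hy0, -⟩ := hdrop 0 h0
    exact ⟨m', y, hy, hy0⟩
  obtain ⟨M, hcM⟩ := unitCreating_of_noThread O A hk hA hfr hAO hPR hne hthr O₁ (hmax O₁ hOO₁)
  have hc₁ : ∃ c ∈ ca (tower O A (M + 1)), c ≠ 0 ∧ c⁻¹ ∈ O₁ :=
    unit_persists O A hPR O₁ hcM (Nat.le_succ M)
  refine relativeACC_tower hD p hp k K O A hk hA hfr hAO O₁ hOO₁.le (M + 1) hc₁ ?_
  intro z hz hdesc
  refine hacc (M + 1) z (fun n => ⟨?_, (hz n).2.1, (hz n).2.2⟩) hdesc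
  obtain ⟨m, hm, hzm⟩ := (hz n).1
  exact tower_le_loc_of_unit O A hk hA hfr hAO hPR O₁ hOO₁.le hc₁ hm (ca_subset _ hzm)

end Summit.ResolutionOfSingularities.ResolutionOfSingularities.Theorems.NoZeno.Coarsening

end
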